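import Summits.CriticalPhenomena.PercolationContinuityZ3.Theorems.Transplant.SkelPhiCorridorKGReach
import Summits.CriticalPhenomena.PercolationContinuityZ3.Theorems.Transplant.SkelPhiCorridorKGYRoute
import HarnessLib

/-!
# N2 (frames-only node `SamePDropOfSkeletonFrm₁`, OPEN), (C) column: **THE CORRIDOR CHAIN OF THE SECOND-AXIS K-G CORRIDOR OF RECORD IN THE RESIDUE'S
# SHAPE, SCHEME-GENERIC** — `Skelφ.reachChainF_of_kgCorrY` (twin of `reachChainF_of_kgCorr`, SkelPhiCorridorKGReach, for `du` along the second axis): for ANY anchored scheme `S : KSchA V ℕ` with `LevelGeom/QSepGeom/StepsGeom/ExitGeom`, an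
# ORIENTED valid run history `(h, e)` (`Valid₂O`), `a' ∈ anchSet (aOf₁O h e) (tgt e)`, a FORWARD onward direction `du ∈ onwardO`, the fresh habitat
# `Ω := E^{aOf₁O}_{x,y} ∪ H^{a'}_{y,y+du}`, and the K-G corridor `kgCorrSchedY hn hv hlay hP₁ hP₂ hsplit` (SkelPhiParaCorridorKGY) read in the x-run frame
# `runX φ c₀ n h_s σ` around `w₀` (radius `R`): the (S0) chain in the habitat graph `winGraphIn G Ω` with source `root`, kits `KitsAtF (Wcor …)`,
# rim excess `≤ η ≤ δ/2`, the arrival cube `M_{aOf₁O}(y) ⊆ X^{(0)}_0` and the last true target inside `M_{a'}(y + du)` — i.e. the body of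
# `Skel.ReachOblAtHNF G nmax S FD Δ' δ h e a' du` (C2-SPEC §2; p3-g15's SkelKitResiduesOF) for every `nmax ≥ N + 1 + m₁ + 1 + m₂`, so that the
# residue is ONE anonymous-constructor away once that file is in the tree.  Composition of the landed/filed layers:
# `chainF_of_seg` (p342579) ∘ `hkits_schedFHab` (SkelPhiCorridorStepsFHab) ∘ `hrouteS_kgCorr` (SkelPhiCorridorKGRoute) ∘ the readings/slots, with the
# oriented habitat rows `isSubbox_Wcor_habO` (§1, O-twin of `Skel.isSubbox_Wcor_hab`, SkelConcReachHab :159, over stmt-g19's `Valid₂O` API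
# `disjoint_Vx_of_freshO/mem_of_adj_freshO/root_not_mem_of_freshO`, KNCells2SepQO ✓) — the one-window twin of N1's `reachOblAtHN_of_chain₂`
# (SkelPhiNegReachHabResG).  What the Geom pen still supplies at `cellGeomSG₂S`: the vertex-form rows `hΩball`, `hreg`, `hcover`, `hTne`, `hM0`,
# `hlastM` (rooms, depth, frame change of the cubes) and the rim excess `hexc` — exactly N1's C-STEP0 §4 list.

builds on p205010 (kernel theorem, internal audit signed; external expert review pending) — nothing in this file uses p205010; nothing here is a
claim about the open node `SamePDropOfSkeletonFrm₁`.
Lane `prim-bschramm`, seat `prim-bschramm-p5` (gen 15; (C) lineage; (R-22)/(R-26)(ii)); helper file (`--supports stmt-CriticalPhenomena-4575 --as helper`).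
* **`Skelφ.reachChainF_of_kgCorrY`**.
[cite: KozmaNitzan2024, §4 Lemma 12 (pp. 23–25), p. 26 (M_x, H_{v,x}), p. 30 (Step IV), p. 31] [cite: MartineauTassion2017, §4.3 Lemma 4.2]
-/

noncomputable section

open MeasureTheory ProbabilityTheory
open scoped ENNReal Classical

namespace Summit.CriticalPhenomena.PercolationContinuityZ3.Theorems

namespace Transplant

/-! ## The corridor chain of the second-axis K-G corridor of record, residue shape -/

namespace Skelφ

open Literature.Probability.Percolation Literature.Probability.LatticeModels SimpleGraph GadgetSystem ProbeHistory HSiteScheme Contour KNCells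
open KNCells.KSchA KNLevels ChainPlanar ChainPara
open Literature.Barriers.CriticalPhenomena (graphBall graphBall_mono)
open Skel (winGraph winGraphIn winGraphIn_le)
open SkelI (tanOff)

variable {V : Type} [DecidableEq V] [Countable V] {G : SimpleGraph V} [G.LocallyFinite] {φ : V → Site 2}

/-- **THE CORRIDOR CHAIN OF THE K-G CORRIDOR OF RECORD IN THE SHAPE OF THE (C) RESIDUE, SCHEME-GENERIC.** See the file header for the list of
inputs; the conclusion is the body of `Skel.ReachOblAtHNF G nmax S FD Δ' δ h e a' du` at `Ω := E^{aOf₁O}_{x,y} ∪ H^{a'}_{y,y+du}`.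
[cite: KozmaNitzan2024, §4 Lemma 12 (pp. 23–25), p. 30 (Step IV), p. 31] [this work] -/
theorem reachChainF_of_kgCorrY
    -- the scheme, the probe
    {S : KSchA V ℕ} {FD : FaceData V ℕ} {LD : LevelData V ℕ}
    (hL : LevelGeom G S.Γ FD LD) (hQ : QSepGeom G S.Γ) (hSt : StepsGeom S.Γ FD) (hEx : ExitGeom G S.Γ)
    {h : ProbeHistory V} {e : Site 2 × MDir} (hV : S.Valid₂O G h e) {a' : ℕ} (ha' : a' ∈ S.Γ.anchSet (S.aOf₁O G h e) (tgt e))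
    {du : MDir} (hdu : du ∈ S.onwardO G h (tgt e))
    -- the skeleton map, the frame
    (hlipφ : Lip G φ) (hstep : Steps G φ) {Δ : ℕ} (hΔ : ∀ v, G.degree v ≤ Δ) {types : Finset V} (hfr : Frames G φ types) (hκ : CylConn G φ types)
    {n ℓ : ℕ} {hs v : ℤ} (hn : 1 ≤ n) (hv : |v| ≤ n) (hlay : (n + hs.natAbs : ℕ) ≤ (n : ℤ) * ℓ + 1) (c₀ : V) {σ : ℤ} (hσ : σ = 1 ∨ σ = -1)
    {kq : ℕ} (hκL : hs.natAbs ≤ kq * n)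
    -- the corridor of record
    {R' ρ qq W N m₁ Wm₂ Wp₂ m₂ : ℕ}
    (hP₁ : ParkOK (kgPark₁Y n ℓ hs v R' ρ qq W N m₁)) (hP₂ : ParkOK (kgPark₂Y n ℓ hs v R' ρ qq W N m₁ Wm₂ Wp₂ m₂))
    (hsplit : (Wm₂ : ℤ) + Wp₂ = (kgPark₁Y n ℓ hs v R' ρ qq W N m₁).aHi (m₁ + 1) - ParkPrm.aLo (kgPark₁Y n ℓ hs v R' ρ qq W N m₁) (m₁ + 1))
    -- the window
    {w₀ : V} {R r Rl : ℕ} (hr : Rl ≤ r) (hrR : r ≤ R)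
    -- kit constants
    (Pk : ApronPrm) {Mz Rs KCmax rs cS cU : ℕ} (hPN : kq + 3 ≤ Pk.N) (hA : Pk.A = (Mz + 1 : ℕ) * (shearUnit n hs : ℤ) + 1)
    (hdD : Pk.d + 2 ≤ shellD Pk) (hDρ : Rs + 1 ≤ shellD Pk) (hKCmax : (shellD Pk + Mz + 1) * (kq + 1) ≤ KCmax)
    (hT : (shellD Pk : ℤ) + KCmax + Rs ≤ tanOff Pk.ℓs Pk.M)
    (hr₀ : Pk.N * (tanOff Pk.ℓs Pk.M + 2) + Pk.N * Pk.d + (KCmax + Rs) ≤ Pk.r₀) (hR : Pk.r₀ ≤ R) (hr₀1 : 1 ≤ Pk.r₀)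
    (hrs : 1 + (Pk.N * (tanOff Pk.ℓs Pk.M + 2) + Pk.N * Pk.d + (KCmax + Rs)) ≤ rs)
    (hcS : (Pk.N + 1) * (tanOff Pk.ℓs Pk.M + 1) + (Pk.N + 1) * Pk.d + (KCmax + 1) + cU ≤ cS)
    (hreach : r + (Pk.N * (tanOff Pk.ℓs Pk.M + 1) + Pk.N * Pk.d + KCmax) ≤ Pk.r₀)
    -- the short region and the zone datum
    (Rg : V → Finset V) (hRg : ∀ c, ∀ u ∈ Rg c, u ∈ graphBall G c Rs) (hRgcard : ∀ c, (Rg c).card ≤ cU) (hcU1 : 1 ≤ cU)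
    (Λc : V → ℕ → Finset V) (kz : ℕ) (hΛRg : ∀ c, Λc c kz ⊆ Rg c) (hzconn : ∀ c, ∀ s ∈ Λc c kz, PathIn G (↑(Λc c kz) : Set V) c s)
    (hcz : ∀ c, c ∈ Λc c kz) {Rk : ℕ} (hkz : 1 ≤ kz) (hRk : cylRadMax G φ types kz (2 * KCmax) ≤ Rk) (hΛcyl : ∀ c, cylBallFin G φ c kz Rk ⊆ Λc c kz)
    -- the chain data
    (Pd : WinChainData V) (hPo : Pd.o = S.Γ.root) (hPS : Pd.Sfin = S.Sx G h e (S.aOf₁O G h e) a' du)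
    (hj0 : tanOff Pk.ℓs Pk.M ≤ Pd.j₀) (hj : Pd.j₁ ≤ Pd.Rlev) (hRl : Pd.Rlev + 1 ≤ R')
    (hE : Pd.j₁ + (Pk.N * (tanOff Pk.ℓs Pk.M + 1) + Pk.N * Pk.d + KCmax) ≤ R')
    {Δ' : ℕ} {δ η : ℝ} (hδ : 0 < δ) (hη : η ≤ δ / 2)
    (kk : ℕ) (hN : kk * (Δ + 1) ^ (2 * rs) ≤ Pd.N) (hk : (1 - (S.p : ℝ) ^ (1 + Δ * cS + cS * cU)) ^ kk ≤ δ)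
    (hcount : 1 / (1 - (S.p : ℝ)) ^ (Δ' * Pd.N) ≤ δ * ((Finset.Icc Pd.j₀ Pd.j₁).card : ℝ))
    -- the habitat rows (vertex form) at `Ω := Ewv (aOf₁O) e.1 e.2 ∪ Hfull a' (tgt e) du`
    (hΩball : ∀ u ∈ graphBall G w₀ R, runX φ c₀ n hs σ u ∈ (kgCorrSchedY hn hv hlay hP₁ hP₂ hsplit).prism →
      u ∈ S.Γ.Ewv (S.aOf₁O G h e) e.1 e.2 ∪ FD.Hfull a' (tgt e) du)
    (hreg : ∀ k ≤ (kgCorrSchedY hn hv hlay hP₁ hP₂ hsplit).N, ∀ u ∈ S.Γ.Ewv (S.aOf₁O G h e) e.1 e.2 ∪ FD.Hfull a' (tgt e) du,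
      runX φ c₀ n hs σ u ∈ (kgCorrSchedY hn hv hlay hP₁ hP₂ hsplit).region k → u ∈ S.Γ.Q (S.aOf₁O G h e) (tgt e) ∪ S.Γ.Efar a' (tgt e) du)
    (hRim : ∀ k, Pd.Rim k ⊆ WinIn (runX φ c₀ n hs σ) (S.Γ.Ewv (S.aOf₁O G h e) e.1 e.2 ∪ FD.Hfull a' (tgt e) du) ((kgCorrSchedY hn hv hlay hP₁ hP₂ hsplit).region k))
    (hcover : ∀ k ≤ (kgCorrSchedY hn hv hlay hP₁ hP₂ hsplit).N,
      ∀ u ∈ WinIn (runX φ c₀ n hs σ) (S.Γ.Ewv (S.aOf₁O G h e) e.1 e.2 ∪ FD.Hfull a' (tgt e) du) ((kgCorrSchedY hn hv hlay hP₁ hP₂ hsplit).region k),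
        u ∉ graphBall G w₀ (R - Pk.r₀) → u ∈ Pd.Rim k)
    (hTne : ∀ k ≤ (kgCorrSchedY hn hv hlay hP₁ hP₂ hsplit).N,
      (WinIn (runX φ c₀ n hs σ) (S.Γ.Ewv (S.aOf₁O G h e) e.1 e.2 ∪ FD.Hfull a' (tgt e) du) (ScheduleNP.core (kgCorrSchedY hn hv hlay hP₁ hP₂ hsplit) (k + 1))).Nonempty)
    (hM0 : ∀ u ∈ S.Γ.M (S.aOf₁O G h e) (tgt e), runX φ c₀ n hs σ u ∈ ScheduleNP.core (kgCorrSchedY hn hv hlay hP₁ hP₂ hsplit) 0)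
    (hlastM : ∀ u ∈ S.Γ.Ewv (S.aOf₁O G h e) e.1 e.2 ∪ FD.Hfull a' (tgt e) du,
      runX φ c₀ n hs σ u ∈ ScheduleNP.core (kgCorrSchedY hn hv hlay hP₁ hP₂ hsplit) ((kgCorrSchedY hn hv hlay hP₁ hP₂ hsplit).N + 1) → u ∈ S.Γ.M a' (tgt e + stepVec du))
    (hexc : ∀ k ≤ (kgCorrSchedY hn hv hlay hP₁ hP₂ hsplit).N,
      (prodBernoulli (S.Wcor G FD h e (S.aOf₁O G h e) a' du)).real (⋃ t' ∈ Pd.Rim k, openConn S.Γ.root t') ≤ η)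
    -- THE LONG LINKS AT EVERY CENTRE at accuracy `δ³`
    (hlong : ∀ c (τ : ℤ), τ = 1 ∨ τ = -1 → 1 - δ ^ 3 < (bondPercolation G S.p).real
      (linkIn (pgramPrism G φ c n hs (3 * ℓ) Rl) (Λc c kz) (pgSideHalfW G φ c n hs ℓ Rl σ (σ * τ))))
    (hlongY : ∀ c (τ : ℤ), τ = 1 ∨ τ = -1 → 1 - δ ^ 3 < (bondPercolation G S.p).real
      (linkIn (pgramPrism G φ c n hs (3 * ℓ) Rl) (Λc c kz) (pgTopPieceW G φ c n hs ℓ Rl σ τ v)))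
    -- the budget
    {nmax : ℕ} (hnmax : (kgCorrSchedY hn hv hlay hP₁ hP₂ hsplit).N ≤ nmax) :
    ∃ (n₀ : ℕ) (_ : n₀ ≤ nmax) (Ω : Finset V) (s : Fin (n₀ + 1) → KNLevels.TStep (winGraphIn G Ω)) (T' : Fin (n₀ + 1) → Finset V) (η' : ℝ),
      (∀ i : Fin (n₀ + 1), (s i).L.o = S.Γ.root) ∧
      (∀ i : Fin n₀, T' (Fin.castSucc i) ⊆ (s i.succ).L.X 0) ∧ (∀ i : Fin (n₀ + 1), T' i ⊆ (s i).T) ∧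
      (∀ i : Fin (n₀ + 1), (s i).KitsAtF (S.Wcor G FD h e (S.aOf₁O G h e) a' du) S.p Δ' δ) ∧ η' ≤ δ / 2 ∧
      (∀ i : Fin (n₀ + 1), (prodBernoulli (S.Wcor G FD h e (S.aOf₁O G h e) a' du)).real (⋃ t ∈ (s i).T \ T' i, openConn S.Γ.root t) ≤ η') ∧
      S.Γ.M (S.aOf₁O G h e) (tgt e) ⊆ (s 0).L.X 0 ∧
      T' (Fin.last n₀) ⊆ S.Γ.M a' (tgt e + stepVec du) := by
  set Ω := S.Γ.Ewv (S.aOf₁O G h e) e.1 e.2 ∪ FD.Hfull a' (tgt e) du with hΩdef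
  set ψ := runX φ c₀ n hs σ with hψ
  set Sc := kgCorrSchedY hn hv hlay hP₁ hP₂ hsplit with hSc
  set 𝒲 := planarWindowIn (lip_runX hlipφ hσ hn c₀ hs) Ω with h𝒲def
  have hScR : Sc.R' = R' := rfl
  -- the habitat rows in window form
  have hDΩ : ∀ k, WinIn ψ Ω (Sc.region k) ⊆ Ω := fun k u hu => ((mem_WinIn (φ := ψ)).1 hu).1
  have hDh : ∀ k ≤ Sc.N, WinIn ψ Ω (Sc.region k) ⊆ S.Γ.Q (S.aOf₁O G h e) (tgt e) ∪ S.Γ.Efar a' (tgt e) du := by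
    intro k hk u hu
    obtain ⟨huΩ, huR⟩ := (mem_WinIn (φ := ψ)).1 hu
    exact hreg k hk u huΩ huR
  have hSx : ∀ {u : V}, u ∈ S.Γ.Q (S.aOf₁O G h e) (tgt e) ∪ S.Γ.Efar a' (tgt e) du → u ∈ S.Sx G h e (S.aOf₁O G h e) a' du := by
    intro u hu
    rcases Finset.mem_union.1 hu with hu' | hu'
    · exact Finset.mem_union_left _ (Finset.mem_union_right _ (Finset.mem_union_right _ hu'))
    · exact Finset.mem_union_right _ hu'
  have hsub : ∀ k ≤ Sc.N, IsSubbox (winGraphIn G Ω) (S.Wcor G FD h e (S.aOf₁O G h e) a' du) S.p (WinIn ψ Ω (Sc.region k)) :=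
    fun k hk => isSubbox_Wcor_habO hL hQ hSt hV hdu ha' (hDΩ k) (hDh k hk)
  -- the per-step per-centre input of the corridor of record, and the per-step clauses
  have hrouteS := hrouteS_kgCorrY hn hv hlay hP₁ hP₂ hsplit (φ := φ) c₀ hσ hr hrR hΩball Pd.Rim hsub Λc kz hlong hlongY
  have hj1R : Pd.j₁ ≤ Sc.R' := by rw [hScR]; omega
  have hkits := hkits_schedFHab hlipφ hstep hΔ hδ hn c₀ hs hσ hκL Sc Pk hPN hA hdD hDρ hKCmax hT hr₀ hR hr₀1 hrs hcS hreach Rg hRg hRgcard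
    hcU1 Λc kz hΛRg hzconn hcz hfr hκ hkz hRk hΛcyl Pd hj0 hj1R hE kk hN hk hΩball hcover hrouteS
  -- the one-segment chain in residue shape
  have hfin : FinSupp (S.Wcor G FD h e (S.aOf₁O G h e) a' du) Pd.Sfin := by rw [hPS]; exact finSupp_Wcor
  have hDS : ∀ k ≤ Sc.N, 𝒲.stepDF Sc.toFrame k ⊆ Pd.Sfin := fun k hk u hu => by rw [hPS]; exact hSx (hDh k hk hu)
  have ho : ∀ k ≤ Sc.N, Pd.o ∉ 𝒲.stepDF Sc.toFrame k := fun k hk => by rw [hPo]; exact root_not_mem_of_freshO hL hQ hV hdu (hDh k hk)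
  have hoS : Pd.o ∈ Pd.Sfin := by rw [hPo, hPS]; exact Finset.mem_union_left _ (Finset.mem_union_left _ hV.root_mem)
  have hB₀ : S.Γ.M (S.aOf₁O G h e) (tgt e) ⊆ 𝒲.W (Sc.toFrame.core 0) := fun u hu =>
    (mem_WinIn (φ := ψ)).2 ⟨Finset.mem_union_left _ (Finset.mem_union_right _ (hEx.M_subset_Q _ _ hu)), hM0 u hu⟩
  obtain ⟨s, T', ho', hlink, hsubT, hkitsF, hexcF, h0, hlast⟩ := Pd.chainF_of_seg 𝒲 Sc.toFrame hRl hRim hTne hsub hfin hDS ho hoS hj hcount hkits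
    (fun k hk => by rw [hPo]; exact hexc k hk) hB₀
  refine ⟨Sc.N, hnmax, Ω, s, T', η, fun i => (ho' i).trans hPo, hlink, hsubT, hkitsF, hη, fun i => by rw [← hPo]; exact hexcF i, h0, ?_⟩
  have hlast' : T' (Fin.last Sc.N) = 𝒲.W (Sc.toFrame.core (Sc.N + 1)) := hlast
  rw [hlast']
  intro u hu
  obtain ⟨huΩ, huC⟩ := (mem_WinIn (φ := ψ)).1 hu
  exact hlastM u huΩ huC

end Skelφ

end Transplant

end Summit.CriticalPhenomena.PercolationContinuityZ3.Theorems

end
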